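import Literature.AnabelianGeometry.EtaleTheta.LogDivisorModelTateTowerThetaTwistTowerSignFree
import Literature.AnabelianGeometry.EtaleTheta.TemperedFrobenioidOfPowDiagonalBase
import Literature.AnabelianGeometry.EtaleTheta.TemperedFrobenioidOfTateTowerThetaCoprimePull
import Literature.AnabelianGeometry.EtaleTheta.DivisorMonoidsOfGaloisCoveringTempered
import Literature.AnabelianGeometry.EtaleTheta.Discharge.Sec3BLambdaInjectiveOfGaloisCoveringConnected
import Literature.AnabelianGeometry.EtaleTheta.Discharge.Sec3Prop34iPhiZero
import Literature.AnabelianGeometry.EtaleTheta.Discharge.Sec3BZeroInjectiveOfTower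
import Literature.AlgebraicGeometry.Frobenioids.QuasiTemperoidConnectedPart
import HarnessLib

/-!
# [EtTh] Def. 3.6 (ii) at the ε-free (β) Kummer tower `towerC₃sf` of the `Ÿ`-skeleton over «GRP₃′»: the tempered Frobenioid over the
# FULL base `B^temp(Compat₃′)⁰` (Tate tower v3, piece 2c FILE 4) — cusps, theta roots, recorded roots of unity, RAMIFIED uniformiser

S. Mochizuki, *The étale theta function and its Frobenioid-theoretic manifestations*, Publ. RIMS **45** (2009) [MochizukiEtTh2009],
§1 p.13 («`K_N := K(ζ_N, q_X^{1/N})`»), Def. 3.3 (iii) / Rmk. 3.3.1 p.73, Def. 3.6 (i)(ii) p.76–77 (`Φ^{bs-fld} := Φ ∩ ℝ·Φ₀^cnst`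
monoprime; (b) a constant with non-trivial divisor), Prop. 1.4 (i) p.21 [cite: MochizukiEtTh2009, Def 3.6 p.77]; [FrdI] Thm. 5.2 (ii) p.100;
[FrdII] Ex. 1.3 p.11.

abc-iut cell, layer L2 [EtTh]; seat abc-iut-L2-d2 (gen 7) ON LOAN to the abc-iut-L2-t3 lineage (abc-iut-L2-lead gen 7 R1021; spec =
abc-iut-L2-t3 g7's `DESIGN-2c-ThetaTowerGrp3.md` §«FINAL UPDATE», design (β) RULED R922).  CLASS (b) construction / non-vacuity witness;
consumed BY NAME, nothing restated: abc-iut-L2-t3's ε-free tower `TateTowerThetaTwist.towerC₃sf` (p488792) over abc-iut-L1-t6's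
compatible shear-semidirect group `Compat 3 thetaShear ≅ Ẑ(1)³ ⋊ (Ẑˣ × ℤ_γ)` (p482446), abc-iut-L2-t3's v2 datum `DivisorMonoids.ofTower`
(p453968 lineage), its `Ÿ`-skeleton coordinates `TateTowerTheta.coord / diag / thetaZerosPhi` (p478021, p481705) and its engine WITH A
RAMIFIED UNIFORMISER `TemperedFrobenioid.ofPowDiagonalBase` (p491637 — the repair of the finding that at «GRP₃′» the Kummer class of `ϖ̈`
ACTS, so only some power `ϖ̈_l^{k}` is a constant over a given covering; found independently as abc-iut-L2-t3 FINDING #5 and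
abc-iut-L2-d2 F-L2d2g7-1), abc-iut-w6-d057's `isPerfFactorialCof_phiZero`, abc-iut-w5-d179's Kummer–Tate template
`TemperedFrobenioidDiagonalOfKummerTateTower` (p468928).
* §0 `TateTowerTheta.theta_pow_dvd_pow_iff` (positive powers reflect divisibility on the skeleton's `Φ₀`; the `B₀`-side input
  `hB₀inj` is abc-iut-L2-t3's `LogDivisorTower.ofTower_B₀_map_injective`).
* §1 THE KEY DEFINITIONAL IDENTITY: the level-`n` action of `towerC₃sf` on LOG-DIVISORS is the `Ÿ`-skeleton action through the
  translation character `φ₃ : Compat₃′ → ℤ_γ` — `(towerC₃sf.act n).phiZero S = (TateTowerTheta.action φ₃).phiZero S` BY `rfl` — so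
  `Φ₀` of `ofTower towerC₃sf` at a covering `A` IS the skeleton's `Φ₀(gset A)` and its transitions are «pull back, then `(−)^{eN}`»
  (`Φ₀_map_hom_eq`), injective and divisibility-reflecting.
* §2 the constants at a level: on a connected `S` every `b ∈ F₀(S)` has a CONSTANT SKELETON PART `ϖ̈_n^c` (the three Kummer classes
  and the character touch only the `μ`-coordinate, the sign-free shear fixes constants), hence `div₀ b = [diag]^c`
  (`divZeroHom_eq_diag_zpow`, `divZeroHom_mem_zpowers_of_mem_fZero`); and the RAMIFIED UNIFORMISER: the constant family
  `ϖ = ϖ̈_n^{N_n}` is fixed by the whole of «GRP₃′» at level `n` (`pairing κ (0, N_n, 0, 0) = N_n • κ_ϖ = 0` in `ℤ/N_n`), lies in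
  `F₀(S)` for EVERY `S`, `div₀ ϖ = [diag]^{N_n}` with `N_n ≥ 1` (`unifPowFam`, `divZeroHom_unifPowFam`).
* §3 **`powDiagonalBase : PowDiagonalBase (ofTower towerC₃sf) (ConnectedPart (BTemp Compat₃′))`** (identity base functor; coordinates =
  multiplicities at `(point, prime log-divisor)`, diagonal = reduced special fibre) and **`ThetaTwistTowerTempered.temperedFrobenioid
  R S`** — Def. 3.6 (ii) data of monoid type `ℤ` over the FULL base `B^temp(Compat₃′)⁰`, EVERY clause proved; it IS a Frobenioid
  (`isFrobenioid_temperedFrobenioid`, `hB₀inj` := `ofTower_B₀_map_injective`), `Φ(A)` perfect (`hP`), `Φ^{bs-fld}(A) = ι(⟨diag⟩^pf)` and **`Φ^{bs-fld} ⊊ Φ` at EVERY covering**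
  (the class of the zero divisor of `Θ̈`: `exists_mem_Φ_not_mem_bsFld`) — the FOURTH tower model of record and the first carrying cusps,
  theta roots, Galois-moved roots of unity AND three acting Kummer classes.
The A10 / E2 (a) knit (`BaseRootLaw` from abc-iut-L2-t3's `rootLawC₃sf`, p490708, and abc-iut-L1-t6's `isTemperedC`) is the proof-only
sequel once p490708 is built.  DEVIATION OF RECORD (design (β), R922): the torsion sign `(−1)^a` of [EtTh] Prop. 1.4 (ii) is not carried
by the level translations (sign-free levels).  HONEST LABEL: a class-(b) combinatorial DESIGN model (finite groups of roots of unity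
adjoined level-wise to the `Ÿ`-skeleton), NOT the tempered Frobenioid of a Tate curve; no Prop-valued fact, no instance, no notation, no
sorry; nothing here bears on [IUTchIII] Cor. 3.12; no side taken; typed ≠ proved.
-/

noncomputable section

namespace Literature.AnabelianGeometry.EtaleTheta

open CategoryTheory Opposite Function Literature.AlgebraicGeometry.Frobenioids Literature.AnabelianGeometry.SemiGraphs
  LogDivisorModel LogDivisorModel.GaloisAction LogDivisorTower


/-! ## §0 Powers reflect divisibility on `Φ₀` of the `Ÿ`-skeleton -/

namespace LogDivisorModel.TateTowerTheta

variable {Γ : Type} [Group Γ] (φ : Γ →* Multiplicative ℤ) (S : Action (Type 0) Γ)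

/-- **Positive powers reflect divisibility** in `Φ₀(S)` of the `Ÿ`-skeleton with cusps and theta (coordinatewise over
`Cusp ⊔ Comp`; the chain-only twin is abc-iut-w5-d179's `ZTower.pow_dvd_pow_iff`). [cite: MochizukiEtTh2009, Def 3.3 p.73] -/
theorem theta_pow_dvd_pow_iff {ψ ψ' : (LogDivisorModel.TateTowerTheta.action φ).phiZero S} {k : ℕ} (hk : 0 < k) :
    ψ ^ k ∣ ψ' ^ k ↔ ψ ∣ ψ' := by
  rw [dvd_iff_toAdd_coord_le, dvd_iff_toAdd_coord_le]
  refine forall_congr' fun s => forall_congr' fun x => ?_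
  rw [map_pow (coord φ S s x), map_pow (coord φ S s x), toAdd_pow, toAdd_pow, smul_eq_mul, smul_eq_mul]
  exact ⟨fun h => Nat.le_of_mul_le_mul_left h hk, fun h => Nat.mul_le_mul_left k h⟩

end LogDivisorModel.TateTowerTheta

/-! ## §1 `Φ₀` of `ofTower towerC₃sf` IS the `Ÿ`-skeleton's `Φ₀` through the translation character -/

namespace ThetaTwistTowerTempered

open LogDivisorModel.TateTowerThetaTwist TateTowerKummerTwistRShear
open TateTowerKummerTwist (N coe_N N_dvd_M eN eN_pos)

/-- The translation character `φ₃ : Compat₃′ → ℤ_γ` of «GRP₃′» (`⟨k, (c, a)⟩ ↦ a`). [cite: MochizukiEtTh2009, Def 3.3 (iii) p.73] -/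
def φ₃ : Compat 3 thetaShear →* Multiplicative ℤ := toTransl.comp (compat 3 thetaShear).subtype

/-- `φ₃ g = a` (the `ℤ_γ`-component). [cite: MochizukiEtTh2009, Def 3.3 (iii) p.73] -/
theorem φ₃_apply (g : Compat 3 thetaShear) : φ₃ g = (g : Grp 3 thetaShear).right.2 := rfl

/-- **KEY IDENTITY** (definitional): at every level the tower acts on log-divisors through the `Ÿ`-skeleton action of `φ₃`, so
`Φ₀` of level `n` on any `Compat₃′`-set IS the skeleton's `Φ₀`. [cite: MochizukiEtTh2009, Def 3.3 (iii) p.73] -/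
theorem phiZero_act_eq (n : ℕ) (S : Action (Type 0) (Compat 3 thetaShear)) :
    (towerC₃sf.act n).phiZero S = (TateTowerTheta.action φ₃).phiZero S := rfl

/-- Every connected tempered `Compat₃′`-covering is one orbit. [cite: MochizukiFrdII2008, Ex 1.3 (ii) p.11] -/
theorem isConnectedGSet_gset (A : ConnectedPart (BTemp (Compat 3 thetaShear))) : isConnectedGSet (gset A) :=
  isConnectedGSet_temperedInclusion A

/-- The Def. 3.3 (iii) v2 datum of the ε-free theta tower. [cite: MochizukiEtTh2009, Def 3.3 (iii) p.73] -/
abbrev dm : DivisorMonoids (ConnectedPart (BTemp (Compat 3 thetaShear))) := DivisorMonoids.ofTower towerC₃sf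

/-- **Prop. 3.4 (i) (weak, cofinal perfection) at every `Φ₀(A)`** — the `hpf` slot (abc-iut-w6-d057's generic theorem at the level of `A`).
[cite: MochizukiEtTh2009, Prop 3.4 p.74] -/
theorem hpf (Y : (ConnectedPart (BTemp (Compat 3 thetaShear)))ᵒᵖ) : IsPerfFactorialCof (dm.Φ₀.obj Y) :=
  LogDivisorModel.GaloisAction.isPerfFactorialCof_phiZero (towerC₃sf.act (lvlC 3 thetaShear Y.unop)) Y.unop.obj.obj

/-- **The v2 transition of `Φ₀` at the tower**: pull back along the covering map, then raise to the ramification index `eN`.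
[cite: MochizukiEtTh2009, Def 3.3 (iii) p.74] -/
theorem Φ₀_map_hom_eq {Y Y' : (ConnectedPart (BTemp (Compat 3 thetaShear)))ᵒᵖ} (f : Y ⟶ Y') (ψ : dm.Φ₀.obj Y) :
    (dm.Φ₀.map f).hom ψ =
      (TateTowerTheta.action φ₃).phiZeroPull f.unop.hom.hom ψ ^ eN (lvlC 3 thetaShear Y.unop) (lvlC 3 thetaShear Y'.unop) :=
  Subtype.ext (funext fun _ => rfl)

/-- The ramification index along a covering map is positive. [cite: MochizukiEtTh2009, Def 3.3 (ii) p.73] -/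
theorem eN_lvl_pos {Y Y' : (ConnectedPart (BTemp (Compat 3 thetaShear)))ᵒᵖ} (f : Y ⟶ Y') :
    0 < eN (lvlC 3 thetaShear Y.unop) (lvlC 3 thetaShear Y'.unop) :=
  eN_pos (lvlC_le_of_hom 3 thetaShear f.unop)

/-- **The transitions of `Φ₀` at the tower are injective.** [cite: MochizukiEtTh2009, Def 3.3 (iii) p.74] -/
theorem Φ₀_map_injective {Y Y' : (ConnectedPart (BTemp (Compat 3 thetaShear)))ᵒᵖ} (f : Y ⟶ Y') : Injective (dm.Φ₀.map f).hom :=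
  fun _ _ h => by
  rw [Φ₀_map_hom_eq, Φ₀_map_hom_eq] at h
  exact phiZeroPull_injective _ f.unop.hom.hom (hom_surjective_temperedInclusion f.unop)
    (TateTowerTheta.pow_left_injective φ₃ _ (eN_lvl_pos f) h)

/-- **The transitions of `Φ₀` at the tower reflect divisibility.** [cite: MochizukiEtTh2009, Def 3.3 (iii) p.74] -/
theorem Φ₀_map_reflects_dvd {Y Y' : (ConnectedPart (BTemp (Compat 3 thetaShear)))ᵒᵖ} (f : Y ⟶ Y') (a b : dm.Φ₀.obj Y)
    (h : (dm.Φ₀.map f).hom a ∣ (dm.Φ₀.map f).hom b) : a ∣ b := by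
  rw [Φ₀_map_hom_eq, Φ₀_map_hom_eq] at h
  have h' : (TateTowerTheta.action φ₃).phiZeroPull f.unop.hom.hom a ∣ (TateTowerTheta.action φ₃).phiZeroPull f.unop.hom.hom b :=
    (TateTowerTheta.theta_pow_dvd_pow_iff φ₃ (gset Y'.unop) (eN_lvl_pos f)).1 h
  exact phiZeroPull_reflects_dvd _ f.unop.hom.hom (hom_surjective_temperedInclusion f.unop) a b h'

/-! ## §2 Constants at a level: constant skeleton part, `div₀ = [diag]^c`; the ramified uniformiser `ϖ = ϖ̈_n^{N_n}` -/

section Level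

variable (n : ℕ) {S : Action (Type 0) (Compat 3 thetaShear)}

/-- The skeleton part of `g · x` at level `n` is the sign-free shear of the skeleton part of `x` (neither the Kummer classes nor the
character see it). [cite: MochizukiEtTh2009, Def 3.3 (iii) p.73] -/
theorem toAdd_snd_actFn (g : Compat 3 thetaShear) (x : (towerC₃sf.Z n).Fn) :
    Multiplicative.toAdd ((towerC₃sf.act n).actFn g x).1.2 =
      shear₀ (Multiplicative.toAdd (φ₃ g)) (Multiplicative.toAdd x.1.2) :=
  (congrArg Multiplicative.toAdd (levelActFnMod_snd n (N n) (N_dvd_M n) (g : Grp 3 thetaShear) x.1)).trans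
    (toAdd_shear₀Fn _ _)

/-- **On a CONNECTED `S`, an element of `F₀(S)` has CONSTANT SKELETON PART `ϖ̈_n^c`** (its `μ`-coordinate may move along the orbit):
`e(b s) = (0, c, 0, 0)` for every `s`, with `c` the `ϖ̈`-exponent at a base point. [cite: MochizukiEtTh2009, Prop 3.4 p.74] -/
theorem toAdd_snd_apply_eq_of_mem_fZero (hS : isConnectedGSet S) (s₀ : S.V) {b : (towerC₃sf.act n).bZero S}
    (hb : b ∈ (towerC₃sf.act n).fZero S) (s : S.V) :
    Multiplicative.toAdd (b.1 s).1.2 =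
      (((0 : ZMod 2), TateTowerTheta.eC (Multiplicative.toAdd (b.1 s₀).1.2), (0 : ℤ), (0 : ℤ)) : TateTowerTheta.Exp) := by
  have hc : ∀ t : S.V, TateTowerTheta.eU (Multiplicative.toAdd (b.1 t).1.2) = 0 ∧
      TateTowerTheta.eT (Multiplicative.toAdd (b.1 t).1.2) = 0 := fun t => hb t
  have h0 : Multiplicative.toAdd (b.1 s₀).1.2 =
      (((0 : ZMod 2), TateTowerTheta.eC (Multiplicative.toAdd (b.1 s₀).1.2), (0 : ℤ), (0 : ℤ)) : TateTowerTheta.Exp) :=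
    TateTowerTheta.ext_exp (b.1 s₀).2 rfl (hc s₀).1 (hc s₀).2
  obtain ⟨g, rfl⟩ := ((isConnectedGSet_iff S).1 hS).2 s₀ s
  have e1 : Multiplicative.toAdd (b.1 (S.ρ g s₀)).1.2 =
      shear₀ (Multiplicative.toAdd (φ₃ g)) (Multiplicative.toAdd (b.1 s₀).1.2) :=
    (congrArg (fun f : (towerC₃sf.Z n).Fn => Multiplicative.toAdd f.1.2) (b.2.2 g s₀)).trans (toAdd_snd_actFn n g _)
  exact e1.trans ((shear₀_eq_self_of_const _ (hc s₀).1 (hc s₀).2).trans h0)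

/-- **`div₀` of an element of `B₀(S)` with constant skeleton part `ϖ̈_n^c` is `[diag]^c`** (the `μ`-coordinate is invisible to `div`;
the cusps never meet a constant's divisor). [cite: MochizukiEtTh2009, Def 3.3 p.73] -/
theorem divZeroHom_eq_diag_zpow {b : (towerC₃sf.act n).bZero S} {c : ℤ}
    (hb : ∀ s, Multiplicative.toAdd (b.1 s).1.2 = (((0 : ZMod 2), c, (0 : ℤ), (0 : ℤ)) : TateTowerTheta.Exp)) :
    (towerC₃sf.act n).divZeroHom S b = Algebra.GrothendieckGroup.of (TateTowerTheta.diag φ₃ S) ^ c := by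
  -- the divisor of `b s` on multiplicities: `c · Σ_j [F_j]`
  have hdiv : ∀ (s : S.V) (x : TateTowerTheta.Idx),
      TateTowerTheta.mlt ((towerC₃sf.act n).divAt S b s) x = c * TateTowerTheta.mlt TateTowerTheta.ones x := fun s x => by
    have e : TateTowerTheta.divFun (((0 : ZMod 2), c, (0 : ℤ), (0 : ℤ)) : TateTowerTheta.Exp) x =
        c * TateTowerTheta.mlt TateTowerTheta.ones x := by
      rcases x with d | j
      · simp [TateTowerTheta.eT, TateTowerTheta.mlt_ones]
      · simp [TateTowerTheta.eC, TateTowerTheta.eU, TateTowerTheta.eT, TateTowerTheta.mlt_ones]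
    exact (congrArg (TateTowerTheta.divFun · x) (hb s)).trans e
  -- `div₀ b = [diag^{c⁺}]/[diag^{c⁻}]` since `div(b s) · diag(s)^{c⁻} = diag(s)^{c⁺}` at every `s` (`c = c⁺ − c⁻`)
  have h : (towerC₃sf.act n).divZeroHom S b = Algebra.GrothendieckGroup.of (TateTowerTheta.diag φ₃ S ^ c.toNat) /
      Algebra.GrothendieckGroup.of (TateTowerTheta.diag φ₃ S ^ (-c).toNat) :=
    ((towerC₃sf.act n).divZeroHom_eq_div_iff S _ _ _).2 fun s => TateTowerTheta.ext_mlt fun x => by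
      -- `mlt (a * b) x = mlt a x + mlt b x` and `(diag ^ k) s = ones ^ k` hold definitionally
      change TateTowerTheta.mlt ((towerC₃sf.act n).divAt S b s) x + TateTowerTheta.mlt (TateTowerTheta.ones ^ (-c).toNat) x =
        TateTowerTheta.mlt (TateTowerTheta.ones ^ c.toNat) x
      rw [hdiv, TateTowerTheta.mlt_pow, TateTowerTheta.mlt_pow, ← add_mul]
      congr 1
      omega
  refine h.trans ?_
  rw [map_pow, map_pow, div_eq_mul_inv, ← zpow_natCast, ← zpow_natCast, ← zpow_neg, ← zpow_add]
  congr 1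
  omega

/-- **`Φ₀^cnst(S)` lies in the cyclic group of the diagonal** (connected `S`). [cite: MochizukiEtTh2009, Def 3.3 p.73] -/
theorem divZeroHom_mem_zpowers_of_mem_fZero (hS : isConnectedGSet S) {b : (towerC₃sf.act n).bZero S}
    (hb : b ∈ (towerC₃sf.act n).fZero S) :
    (towerC₃sf.act n).divZeroHom S b ∈ Subgroup.zpowers (Algebra.GrothendieckGroup.of (TateTowerTheta.diag φ₃ S)) := by
  obtain ⟨s₀⟩ := ((isConnectedGSet_iff S).1 hS).1
  rw [divZeroHom_eq_diag_zpow n (toAdd_snd_apply_eq_of_mem_fZero n hS s₀ hb)]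
  exact ⟨_, rfl⟩

/-- The uniformiser `ϖ = ϖ̈_n^{N_n}` read at level `n`: `(1, ϖ̈_n^{N_n})`, ε-free. [cite: MochizukiEtTh2009, §1 p.13] -/
def unifPow : (towerC₃sf.Z n).Fn :=
  ⟨((1 : TateTowerKummerTwist.MuN n), Multiplicative.ofAdd ((((0 : ZMod 2), ((N n : ℕ) : ℤ), (0 : ℤ), (0 : ℤ)) : TateTowerTheta.Exp))),
    rfl⟩

/-- **`ϖ` is FIXED by the whole of «GRP₃′» at level `n`**: the ϖ-Kummer class pairs to `N_n • κ_ϖ = 0` in `ℤ/N_n`, the character sees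
`1 ∈ μ`, the sign-free shear fixes constants. [cite: MochizukiEtTh2009, §1 p.13] -/
theorem actFn_unifPow (g : Compat 3 thetaShear) : (towerC₃sf.act n).actFn g (unifPow n) = unifPow n := by
  refine Subtype.ext ?_
  change levelActFnMod n (N n) (N_dvd_M n) (g : Grp 3 thetaShear)
      ((1 : TateTowerKummerTwist.MuN n), Multiplicative.ofAdd ((((0 : ZMod 2), ((N n : ℕ) : ℤ), (0 : ℤ), (0 : ℤ)) : TateTowerTheta.Exp))) =
    ((1 : TateTowerKummerTwist.MuN n), Multiplicative.ofAdd ((((0 : ZMod 2), ((N n : ℕ) : ℤ), (0 : ℤ), (0 : ℤ)) : TateTowerTheta.Exp)))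
  have hconst : (((1 : TateTowerKummerTwist.MuN n),
      Multiplicative.ofAdd ((((0 : ZMod 2), ((N n : ℕ) : ℤ), (0 : ℤ), (0 : ℤ)) : TateTowerTheta.Exp))) :
        Fn (TateTowerKummerTwist.MuN n)) ∈ (TateTowerThetaTwist.model (TateTowerKummerTwist.MuN n)).const := ⟨rfl, rfl⟩
  rw [levelActFnMod_apply, MulAut.mul_apply, MulAut.mul_apply, translAction_apply, translAut_of_const _ _ hconst,
    constAction_apply', map_one, kumActMod_apply]
  have hpair : ∀ κ : Fin 3 → ZMod (N n),
      pairing κ (((0 : ZMod 2), ((N n : ℕ) : ℤ), (0 : ℤ), (0 : ℤ)) : TateTowerTheta.Exp) = 0 := fun κ => by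
    simp only [pairing, TateTowerTheta.eC, TateTowerTheta.eU, TateTowerTheta.eT, zero_smul, add_zero, zsmul_eq_mul,
      Int.cast_natCast, ZMod.natCast_self, zero_mul]
  refine Prod.ext ?_ rfl
  rw [kummerAut_fst, one_mul, ofAdd_eq_one]
  exact hpair _

/-- **The constant family `ϖ` on any `Compat₃′`-set `S`**, an element of `B₀(S)` at level `n`. [cite: MochizukiEtTh2009, Def 3.3 p.73] -/
def unifPowFam (S : Action (Type 0) (Compat 3 thetaShear)) : (towerC₃sf.act n).bZero S :=
  ⟨fun _ => unifPow n, fun _ => trivial, fun g _ => (actFn_unifPow n g).symm⟩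

/-- `ϖ ∈ F₀(S)`. [cite: MochizukiEtTh2009, Def 3.3 p.73] -/
theorem unifPowFam_mem_fZero (S : Action (Type 0) (Compat 3 thetaShear)) : unifPowFam n S ∈ (towerC₃sf.act n).fZero S :=
  fun _ => show TateTowerTheta.eU _ = 0 ∧ TateTowerTheta.eT _ = 0 from ⟨rfl, rfl⟩

/-- **`div₀ ϖ = [diag]^{N_n}`** at level `n` — the uniformiser is RAMIFIED of index `N_n = (n+1)!` over the reduced special fibre.
[cite: MochizukiEtTh2009, Def 3.3 (iii) p.74] -/
theorem divZeroHom_unifPowFam (S : Action (Type 0) (Compat 3 thetaShear)) :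
    (towerC₃sf.act n).divZeroHom S (unifPowFam n S) = Algebra.GrothendieckGroup.of (TateTowerTheta.diag φ₃ S) ^ ((N n : ℕ) : ℤ) :=
  divZeroHom_eq_diag_zpow n fun _ => rfl

end Level

/-! ## §3 The diagonal base data with ramified uniformiser and the tempered Frobenioid over the FULL base -/

/-- **Pattern diagonal base data of the ε-free theta tower over the WHOLE of `B^temp(Compat₃′)⁰`** (identity base functor): coordinates =
multiplicities `coord φ₃ (s, x)` at every point `s` and prime log-divisor `x ∈ Cusp ⊔ Comp`, read at the covering's own level; diagonal =
the reduced special fibre `diag` (`1` on components, `0` at cusps); constants' divisors `⊆ ⟨[diag]⟩`; the RAMIFIED uniformiser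
`ϖ = ϖ̈_l^{N_l}` supplies `div₀ ϖ = [diag]^{N_l}`, `N_l ≥ 1`. [cite: MochizukiEtTh2009, Def 3.6 p.77] -/
def powDiagonalBase : TemperedFrobenioid.PowDiagonalBase dm (ConnectedPart (BTemp (Compat 3 thetaShear))) where
  F := 𝟭 _
  I A := (gset A).V × TateTowerTheta.Idx
  i₀ A := ((isConnectedGSet_gset A).1.some, Sum.inr 0)
  κ A i := TateTowerTheta.coord φ₃ (gset A) i.1 i.2
  d A := TateTowerTheta.diag φ₃ (gset A)
  κ_d₀ A := TateTowerTheta.coord_diag φ₃ (gset A) _ _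
  eq_pow_of_κ_eq A _ c h := TateTowerTheta.coord_separating φ₃ (gset A) fun s x =>
    (h (s, x)).trans (map_pow (TateTowerTheta.coord φ₃ (gset A) s x) _ c).symm
  div₀_mem_zpowers A _ hb := divZeroHom_mem_zpowers_of_mem_fZero (lvlC 3 thetaShear A) (isConnectedGSet_gset A) hb
  exists_div₀_eq_pow A := ⟨unifPowFam (lvlC 3 thetaShear A) (gset A), unifPowFam_mem_fZero _ _, (N (lvlC 3 thetaShear A) : ℕ),
    PNat.pos _, (divZeroHom_unifPowFam (lvlC 3 thetaShear A) (gset A)).trans (zpow_natCast _ _)⟩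
  hΦinj f := Φ₀_map_injective f.op
  hΦrefl f a b h := Φ₀_map_reflects_dvd f.op a b h

/-- The base functor of the data is the identity. [cite: MochizukiEtTh2009, Def 3.6 p.77] -/
@[simp] theorem powDiagonalBase_F : powDiagonalBase.F = 𝟭 _ := rfl

/-- The diagonal of the data at `A` is `diag`. [cite: MochizukiEtTh2009, Def 3.6 p.77] -/
@[simp] theorem powDiagonalBase_d (A : ConnectedPart (BTemp (Compat 3 thetaShear))) :
    powDiagonalBase.d A = TateTowerTheta.diag φ₃ (gset A) := rfl

variable (R S : ((ConnectedPart (BTemp (Compat 3 thetaShear)))ᵒᵖ ⥤ CommMonCat.{0}) → Prop)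

/-- **The tempered Frobenioid of the ε-free (β) theta tower over the FULL base `B^temp(Compat₃′)⁰`** (abc-iut-L2-t3's engine with a
ramified uniformiser along the data above): monoid type `ℤ`, `Φ := im(Φ₀^pf → Φ₀^rlf)`, every Def. 3.6 (ii) clause proved.
[cite: MochizukiEtTh2009, Def 3.6 p.77] -/
def temperedFrobenioid :
    TemperedFrobenioid (RealifiedDivisorMonoids.ofRlfZWeak dm hpf) (ConnectedPart (BTemp (Compat 3 thetaShear)))
      (treeCatVocab (ConnectedPart (BTemp (Compat 3 thetaShear))) R S) :=
  TemperedFrobenioid.ofPowDiagonalBase hpf powDiagonalBase QuasiTemperoid.BTempConnected.connectedPart_isConnected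
    QuasiTemperoid.BTempConnected.connectedPart_isTotallyEpimorphic QuasiTemperoid.BTempConnected.connectedPart_isOfFSMType R S

/-- **Non-vacuity**: the tempered Frobenioid over the ε-free theta tower exists for every vocabulary choice `R`, `S`.
[cite: MochizukiEtTh2009, Def 3.6 p.77] -/
theorem nonempty_temperedFrobenioid :
    Nonempty (TemperedFrobenioid (RealifiedDivisorMonoids.ofRlfZWeak dm hpf) (ConnectedPart (BTemp (Compat 3 thetaShear)))
      (treeCatVocab (ConnectedPart (BTemp (Compat 3 thetaShear))) R S)) :=
  ⟨temperedFrobenioid R S⟩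

/-- Its base functor is the identity of `B^temp(Compat₃′)⁰`. [cite: MochizukiEtTh2009, Def 3.6 p.77] -/
theorem temperedFrobenioid_base : (temperedFrobenioid R S).base = 𝟭 _ := rfl

/-- The base functor is full. [cite: MochizukiEtTh2009, Def 4.1 p.86] -/
theorem temperedFrobenioid_base_full : (temperedFrobenioid R S).base.Full := by
  rw [temperedFrobenioid_base]; infer_instance

/-- The base functor is essentially surjective. [cite: MochizukiEtTh2009, Def 4.1 p.86] -/
theorem temperedFrobenioid_base_essSurj : (temperedFrobenioid R S).base.EssSurj := by
  rw [temperedFrobenioid_base]; infer_instance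

/-- `Φ(A) = im(Φ₀(A)^pf → Φ₀(A)^rlf)`. [cite: MochizukiEtTh2009, Def 3.6 p.77] -/
theorem temperedFrobenioid_Φ_carrier (A : (ConnectedPart (BTemp (Compat 3 thetaShear)))ᵒᵖ) :
    (temperedFrobenioid R S).Φ.carrier A = powDiagonalBase.pfImage hpf A := rfl

/-- **Def. 3.6 (ii)(a) WITH CONTENT: `Φ^{bs-fld}(A) = ι(⟨diag⟩^pf)`** (the roots of the powers of the reduced special fibre).
[cite: MochizukiEtTh2009, Def 3.6 p.77] -/
theorem temperedFrobenioid_bsFld_carrier (A : (ConnectedPart (BTemp (Compat 3 thetaShear)))ᵒᵖ) :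
    (temperedFrobenioid R S).bsFld.carrier A = powDiagonalBase.diagImage hpf A :=
  TemperedFrobenioid.ofPowDiagonalBase_bsFld_carrier hpf powDiagonalBase _ _ _ R S A

/-- **It IS a Frobenioid** ([FrdI] Thm. 5.2 (ii); `hB₀inj` = abc-iut-L2-t3's `ofTower_B₀_map_injective`). [cite: MochizukiFrdI2008, Thm. 5.2 (ii) p.100] -/
theorem isFrobenioid_temperedFrobenioid : PreFrobenioid.IsFrobenioid (temperedFrobenioid R S).toElem :=
  TemperedFrobenioid.isFrobenioid_ofPowDiagonalBase hpf powDiagonalBase _ _ _ R S fun g => towerC₃sf.ofTower_B₀_map_injective g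

/-- `Φ(A)` is perfect — the `hP` slot of the §4 setting. [cite: MochizukiEtTh2009, Def 4.1 p.86] -/
theorem hP (A : (ConnectedPart (BTemp (Compat 3 thetaShear)))ᵒᵖ) : IsPerfect ((temperedFrobenioid R S).Φ.carrier A) :=
  TemperedFrobenioid.ofPowDiagonalBase_isPerfect hpf powDiagonalBase _ _ _ R S A

/-! ### `Φ^{bs-fld} ⊊ Φ` at EVERY covering: the class of the zero divisor of `Θ̈` -/

/-- The class `ι((div₊ Θ̈)^{1/1}) ∈ Φ(A)` of the zero divisor of `Θ̈` (all cusps, multiplicity `1`). [cite: MochizukiEtTh2009, Prop 1.4 p.21] -/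
theorem thetaZeros_mem_Φ (A : ConnectedPart (BTemp (Compat 3 thetaShear))) :
    (hpf (op A)).weak.toRealification (Perfection.of _ (TateTowerTheta.thetaZerosPhi φ₃ (gset A))) ∈
      (temperedFrobenioid R S).Φ.carrier (op A) :=
  ⟨_, rfl⟩

/-- **`Φ^{bs-fld}(A) ⊊ Φ(A)` at EVERY connected tempered covering `A`**: the class of the zero divisor of `Θ̈` lies in `Φ(A)` but not in
`ι(⟨diag⟩^pf) = Φ^{bs-fld}(A)` (cusps vs components: no positive power of it is a power of the diagonal). [cite: MochizukiEtTh2009, Def 3.6 p.77] -/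
theorem exists_mem_Φ_not_mem_bsFld (A : ConnectedPart (BTemp (Compat 3 thetaShear))) :
    ∃ x ∈ (temperedFrobenioid R S).Φ.carrier (op A), x ∉ (temperedFrobenioid R S).bsFld.carrier (op A) := by
  haveI : Nonempty (gset A).V := (isConnectedGSet_gset A).1
  have hM := hpf (op A)
  refine ⟨hM.weak.toRealification (Perfection.of _ (TateTowerTheta.thetaZerosPhi φ₃ (gset A))), thetaZeros_mem_Φ R S A, ?_⟩
  rw [temperedFrobenioid_bsFld_carrier]
  rintro ⟨b, hb⟩
  obtain ⟨⟨c, n⟩, rfl⟩ := Perfection.mk_surjective b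
  have h1 : Perfection.mk (TateTowerTheta.diag φ₃ (gset A) ^ Multiplicative.toAdd c) n =
      Perfection.mk (TateTowerTheta.thetaZerosPhi φ₃ (gset A)) 1 :=
    PfImageWeak.toRealification_injective hM.weak hb
  obtain ⟨K, hK⟩ := Perfection.mk_eq_mk_iff.mp h1
  rw [← pow_mul, PNat.one_coe, mul_one] at hK
  exact TateTowerTheta.thetaZerosPhi_pow_ne_diag_pow φ₃ (gset A) (Nat.mul_ne_zero K.ne_zero n.ne_zero) _ hK.symm

/-- **THE FOURTH TOWER MODEL OF RECORD, in one line**: over the ε-free (β) Kummer tower of the `Ÿ`-skeleton with cusps, theta roots and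
level-wise recorded roots of unity under «GRP₃′», there is a tempered Frobenioid over the FULL base which is a Frobenioid, has perfect
`Φ`, and has `Φ^{bs-fld} ⊊ Φ` at every covering; and the theta class MOVES the root `Θ̈_n` (abc-iut-L2-t3's `actFn_kumThetaC_theta_ne`).
[cite: MochizukiEtTh2009, Def 3.6 p.77] -/
theorem temperedFrobenioid_summary :
    PreFrobenioid.IsFrobenioid (temperedFrobenioid R S).toElem ∧
      (∀ A, IsPerfect ((temperedFrobenioid R S).Φ.carrier A)) ∧
      (∀ A : ConnectedPart (BTemp (Compat 3 thetaShear)),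
        ∃ x ∈ (temperedFrobenioid R S).Φ.carrier (op A), x ∉ (temperedFrobenioid R S).bsFld.carrier (op A)) ∧
      ∀ n : ℕ, 1 ≤ n → (towerC₃.act n).actFn kumThetaC (theta (TateTowerKummerTwist.MuN n)) ≠ theta (TateTowerKummerTwist.MuN n) :=
  ⟨isFrobenioid_temperedFrobenioid R S, hP R S, exists_mem_Φ_not_mem_bsFld R S, fun _ hn => actFn_kumThetaC_theta_ne hn⟩

end ThetaTwistTowerTempered

end Literature.AnabelianGeometry.EtaleTheta

end
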